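import Summits.QuantumFields.BalabanUV.T4Continuum.Spine.NE3.AxialGaugeDivergence
import Summits.QuantumFields.BalabanUV.T4Continuum.Spine.NE3.SupRegularityCurvedUniform
import Summits.QuantumFields.BalabanUV.T4Continuum.Support.NE3CurvedCornerGaugeSpace
import HarnessLib

/-!
# NE7PointedSupRegularity — THE POINTED (H0_W)ₚ WITH LEVEL-UNIFORM CONSTANTS: for a skew periodic generator PINNED AT THE BLOCK CORNERS (`u(M•z) = 0`) at a background `W`
# of the class with covariant plaquette gradients `≤ x₁`, `‖D_W u‖_∞ ≤ 36d²·M·‖Δ_W u‖_∞` and `‖u‖_∞ ≤ 36d³·M²·‖Δ_W u‖_∞` under `23040d⁶M²x ≤ 1`, `11520d⁷M³x₁ ≤ 1` — one of the two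
# sup letters of «REP WITH A FIXED TOP» (memo `t4/b2b-balaban-t4-ne7-p1-g76/TT-CURVED-LETTER.md` §9), the first DISCHARGED; file 17

Cell `pub-balaban`, rung (B)+1 sub-cell t4, lineage `b2b-balaban-t4-ne7-p1` (CRUX PROVER NE7 #1 = OWNER of row NE7), generation 76.  File F83 (over pub-balaban-gaps ne3's
generic bootstrap `Spine/NE3/SupRegularityLocalGauge.supRegularity_of_localGauge` (sup regularity of `Δ_W` from LOCAL near-identity gauges with divergence control and ANY covariant
sup shape `‖u‖_∞ ≤ C_U‖D_Wu‖_∞`), `AxialGaugeDivergence.norm_axialDivergence_le` ∕ `LandauCorrectionSupB8LocalGauge.norm_axial_sub_one_le_cube` (the axial local gauges),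
`SupRegularityCurvedUniform.exists_radius_line` (the choice `R = ⌈8dFM⌉`), `NE3CurvedCornerGaugeSpace` (corner walks), `SkeletonLattice` (`cdiv`, `cmod`)).
WHY.  F82 `NE7PointedLandauRep.exists_pointedLandauRep_W_of_supFacts` — the Landau representative PINNED at the top corners — is stated modulo two sup letters of `Δ_W` on the
POINTED gauge algebra; row NE3's (H0_W) (`SupRegularityCurvedUniform.supRegularity_uniform`) is the mean-zero-class version, whose only class-specific input is the covariant sup
block-mean shape `‖u‖_∞ ≤ (frameC+d)M·‖D_Wu‖_∞` (`norm_le_of_mem_avgKernelGauges`).  For a POINTED generator that shape is ELEMENTARY and SHARPER: walk from the block corner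
(where `u = 0`) along at most `d(M−1)` forward bonds, each changing `u` by at most `‖D_Wu‖_∞` up to an isometry — `‖u‖_∞ ≤ dM·‖D_Wu‖_∞`.  The rest is the generic bootstrap
with `C_U = dM`, i.e. `F = d` in `exists_radius_line`.
WHAT ([folklore]; 0 def, 0 sorry).
§1 `norm_walk_le` (quantitative corner walk), **`norm_le_of_pointed`** (`‖u‖_∞ ≤ dM·s` for `u(M•z) = 0`, `‖D_Wu‖_∞ ≤ s`).
§2 **`supRegularity_pointed`** — (H0_W)ₚ: `W` unitary `(N·M)`-periodic (`M = L^{j+1}`, `L ≥ 2`), `SmallField W x`, covariant plaquette gradients `≤ x₁`, `23040d⁴·d²·M²x ≤ 1`,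
   `11520d⁴·d³·M³x₁ ≤ 1`; `u` `(N·M)`-periodic with `u(M•z) = 0`, `‖Δ_Wu‖_∞ ≤ B` ⟹ `‖D_Wu‖_∞ ≤ 36d·d·M·B`, `‖u‖_∞ ≤ 36d·d²·M²·B` (F82's `hG` shape with `c₁ = 36d²`, `c₀ = 36d³`).
HONEST FRAMING (page 1): lattice analysis at a fixed background over tree lemmas; (HR_W)ₚ (the pointed projection's sup bound) is NOT here; nothing of Bałaban's asserted; (APE)
NOT proved; NOT ONE-STEP, NOT NE7; spine 0∕9; finite T⁴ rung (B)+1 — NOT infinite volume, NOT mass gap, NOT `BetaPertH`, NOT Clay.  Continuum YM on T⁴ ⇐ BetaPertH ∧ nine spine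
estimates (0/9 proved); BetaPertH ⇐ (D1) ∧ (D4) ∧ CAP+tail; G-an2-4 gates asym, D1 and NE2/3/4.
-/

set_option autoImplicit false

open scoped BigOperators Matrix Matrix.Norms.L2Operator
open NormedSpace Finset

namespace Summit.QuantumFields.BalabanUV.T4Continuum.NE7PointedSupRegularity

open Literature.MathematicalPhysics.QuantumFieldTheory.Balaban1983to89
open B7Prop1Explicit B7Prop2Explicit
open T4AveragingDeficitWall (Ad IsUnitaryCfg SmallField)
open T4AveragingDeficitWallBoundary (IsPeriodicCfg periodBox)
open AveragingDeficitTransport (norm_Ad_of_unitary)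
open BlockAveragePushDirGauge (gaugeDir)
open SkeletonLattice (cdiv cmod smul_cdiv_add_cmod cmod_nonneg cmod_lt)
open NE3.PairLandauB8 (covLapSite)
open NE3.SupRegularityLocalGauge (supRegularity_of_localGauge)
open NE3.LandauCorrectionSupB8LocalGauge (norm_axial_sub_one_le_cube)
open NE3.AxialGaugeDivergence (norm_axialDivergence_le)
open NE3.SupRegularityCurvedUniform (exists_radius_line)

noncomputable section

variable {d : ℕ} {n : Type*} [Fintype n] [DecidableEq n]

/-! ## §1 The covariant sup shape of a pointed generator -/

/-- **THE QUANTITATIVE CORNER WALK**: `W` unitary, `‖gaugeDir W η x μ‖ ≤ s` everywhere; then for every `v ≥ 0` with `Σ_i v_i = m`,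
`‖η (x + v)‖ ≤ ‖η x‖ + m·s` (one forward bond changes `η` by at most `s` up to the isometry `Ad_{W⁻¹}`). [folklore] -/
theorem norm_walk_le [Nonempty n] {W : Site d → Fin d → (Matrix n n ℂ)ˣ} (hWu : IsUnitaryCfg W) {η : Site d → Matrix n n ℂ} {s : ℝ}
    (hg : ∀ (x : Site d) (μ : Fin d), ‖gaugeDir W η x μ‖ ≤ s) :
    ∀ (m : ℕ) (x v : Site d), (∀ i, 0 ≤ v i) → ∑ i, v i = (m : ℤ) → ‖η (x + v)‖ ≤ ‖η x‖ + m * s := by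
  intro m
  induction m with
  | zero =>
    intro x v hv hsum
    have hv0 : v = 0 := by
      funext i
      have := (Finset.sum_eq_zero_iff_of_nonneg fun j _ => hv j).1 (by exact_mod_cast hsum) i (Finset.mem_univ i)
      simpa using this
    rw [hv0, add_zero]; simp
  | succ m ih =>
    intro x v hv hsum
    have hex : ∃ i, 0 < v i := by
      by_contra hne
      simp only [not_exists, not_lt] at hne
      have hall : ∀ i, v i = 0 := fun i => le_antisymm (hne i) (hv i)
      have : ∑ i, v i = 0 := Finset.sum_eq_zero fun i _ => hall i
      rw [this] at hsum
      exact absurd hsum (by push_cast; omega)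
    obtain ⟨i, hi⟩ := hex
    set v' : Site d := v - e i with hv'
    have hv'nn : ∀ j, 0 ≤ v' j := by
      intro j
      simp only [hv', Pi.sub_apply, e_apply]
      split_ifs with h
      · subst h; omega
      · linarith [hv j]
    have hsum' : ∑ j, v' j = (m : ℤ) := by
      have h1 : ∑ j, v' j = ∑ j, v j - ∑ j : Fin d, e i j := by
        simp only [hv', Pi.sub_apply, Finset.sum_sub_distrib]
      have h2 : ∑ j : Fin d, e i j = 1 := by
        simp only [e_apply, Finset.sum_ite_eq', Finset.mem_univ, if_true]
      rw [h1, h2, hsum]; push_cast; ring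
    have hstep := ih x v' hv'nn hsum'
    have hxv : x + v = (x + v') + e i := by rw [hv']; abel
    rw [hxv]
    -- one forward bond: `η(z + e_i) = Ad_{W(z,i)⁻¹} η(z) − gaugeDir W η z i`
    set z : Site d := x + v' with hz
    have hid : η (z + e i) = Ad (W z i)⁻¹ (η z) - gaugeDir W η z i := by
      simp only [gaugeDir, sub_sub_cancel]
    rw [hid]
    have hAd : ‖Ad (W z i)⁻¹ (η z)‖ = ‖η z‖ := norm_Ad_of_unitary ((unitaryUnits (Matrix n n ℂ)).inv_mem (hWu z i)) _
    calc ‖Ad (W z i)⁻¹ (η z) - gaugeDir W η z i‖ ≤ ‖Ad (W z i)⁻¹ (η z)‖ + ‖gaugeDir W η z i‖ := norm_sub_le _ _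
      _ ≤ (‖η x‖ + m * s) + s := by rw [hAd]; exact add_le_add hstep (hg z i)
      _ = ‖η x‖ + ((m + 1 : ℕ) : ℝ) * s := by push_cast; ring

/-- **THE COVARIANT SUP SHAPE OF A POINTED GENERATOR**: `W` unitary, `M ≥ 1`, `u (M•w) = 0` for all `w`, `‖gaugeDir W u‖_∞ ≤ s` ⟹ `‖u y‖ ≤ (d·M)·s` for every `y`
(walk from the corner of the block of `y`: at most `d(M−1)` forward bonds). [folklore] -/
theorem norm_le_of_pointed [Nonempty n] (hd : 1 ≤ d) {M : ℕ} (hM : 1 ≤ M) {W : Site d → Fin d → (Matrix n n ℂ)ˣ} (hWu : IsUnitaryCfg W)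
    {u : Site d → Matrix n n ℂ} (hu0 : ∀ w : Site d, u ((M : ℤ) • w) = 0) {s : ℝ} (hs : ∀ (x : Site d) (μ : Fin d), ‖gaugeDir W u x μ‖ ≤ s)
    (y : Site d) : ‖u y‖ ≤ ((d : ℝ) * M) * s := by
  have hs0 : 0 ≤ s := (norm_nonneg _).trans (hs y ⟨0, hd⟩)
  have hy : (M : ℤ) • cdiv M y + cmod M y = y := smul_cdiv_add_cmod (L := M) y
  have hnn : ∀ i, 0 ≤ cmod M y i := fun i => cmod_nonneg (L := M) hM y i
  have hsum : ∑ i, cmod M y i = ((∑ i, cmod M y i).toNat : ℤ) := (Int.toNat_of_nonneg (Finset.sum_nonneg fun i _ => hnn i)).symm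
  set m : ℕ := (∑ i, cmod M y i).toNat with hm
  have hwalk := norm_walk_le hWu hs m ((M : ℤ) • cdiv M y) (cmod M y) hnn hsum
  rw [hy, hu0, norm_zero, zero_add] at hwalk
  -- `m ≤ d·M`
  have hmle : (m : ℝ) ≤ (d : ℝ) * M := by
    have h1 : (m : ℤ) ≤ d * M := by
      rw [← hsum]
      calc ∑ i, cmod M y i ≤ ∑ _i : Fin d, (M : ℤ) := Finset.sum_le_sum fun i _ => (cmod_lt (L := M) hM y i).le
        _ = d * M := by simp
    exact_mod_cast h1
  exact hwalk.trans (mul_le_mul_of_nonneg_right hmle hs0)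

/-! ## §2 (H0_W)ₚ with level-uniform constants -/

/-- **THE POINTED (H0_W) WITH LEVEL-UNIFORM CONSTANTS** (statement in the module docstring, §2): the generic bootstrap `supRegularity_of_localGauge` with the axial local gauges
of `AxialGaugeDivergence`, the covariant sup shape `C_U = d·M` of §1, and the radius `R = ⌈8d·d·M⌉` of `exists_radius_line` (`F = d`). [folklore] -/
theorem supRegularity_pointed [Nonempty n] (hd : 1 ≤ d) {L N : ℕ} [NeZero N] (hL : 2 ≤ L) (j : ℕ)
    {W : Site d → Fin d → (Matrix n n ℂ)ˣ} {x x₁ : ℝ} (hWu : IsUnitaryCfg W) (hWP : IsPeriodicCfg W ((N * L ^ (j + 1) : ℕ) : ℤ))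
    (hx : 0 ≤ x) (hWx : SmallField W x) (hx10 : 0 ≤ x₁)
    (hgrad : ∀ (p : Site d) (μ κ : Fin d), κ ≠ μ →
      ‖Ad (W p μ) ((hol W (p + e μ) (plaqWord κ μ) : (Matrix n n ℂ)ˣ) : Matrix n n ℂ) - ((hol W p (plaqWord κ μ) : (Matrix n n ℂ)ˣ) : Matrix n n ℂ)‖ ≤ x₁)
    (hbx : 23040 * (d : ℝ) ^ 4 * (d : ℝ) ^ 2 * ((L : ℝ) ^ (j + 1)) ^ 2 * x ≤ 1)
    (hcx : 11520 * (d : ℝ) ^ 4 * (d : ℝ) ^ 3 * ((L : ℝ) ^ (j + 1)) ^ 3 * x₁ ≤ 1)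
    {u : Site d → Matrix n n ℂ} (huP : ∀ (y : Site d) (i : Fin d), u (y + ((N * L ^ (j + 1) : ℕ) : ℤ) • e i) = u y)
    (hu0 : ∀ w : Site d, u ((((L ^ (j + 1) : ℕ) : ℤ)) • w) = 0) {B : ℝ} (hB : ∀ y : Site d, ‖covLapSite W u y‖ ≤ B) :
    (∀ (y : Site d) (μ : Fin d), ‖gaugeDir W u y μ‖ ≤ 36 * d * (d : ℝ) * (L : ℝ) ^ (j + 1) * B) ∧
      (∀ y : Site d, ‖u y‖ ≤ 36 * d * (d : ℝ) ^ 2 * ((L : ℝ) ^ (j + 1)) ^ 2 * B) := by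
  have hL1 : 1 ≤ L := by omega
  have hN : 1 ≤ N := Nat.one_le_iff_ne_zero.mpr (NeZero.ne N)
  have hP : 1 ≤ N * L ^ (j + 1) := Nat.mul_pos (by omega) (Nat.one_le_pow _ _ hL1)
  have hMnat : 1 ≤ L ^ (j + 1) := Nat.one_le_pow _ _ hL1
  have hd1 : (1 : ℝ) ≤ d := by exact_mod_cast hd
  have hM : (1 : ℝ) ≤ (L : ℝ) ^ (j + 1) := one_le_pow₀ (by exact_mod_cast hL1)
  have hB0 : 0 ≤ B := (norm_nonneg _).trans (hB 0)
  obtain ⟨R, hR1, hR9, hline⟩ := exists_radius_line hd (F := (d : ℝ)) (M := (L : ℝ) ^ (j + 1)) hd1 hM hx hx10 hbx hcx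
  -- the covariant sup shape of the pointed generator: `C_U = d·M`
  have hU : ∀ s : ℝ, (∀ (y : Site d) (μ : Fin d), ‖gaugeDir W u y μ‖ ≤ s) → ∀ y : Site d, ‖u y‖ ≤ ((d : ℝ) * (L : ℝ) ^ (j + 1)) * s := by
    intro s hs y
    have h := norm_le_of_pointed hd hMnat hWu hu0 hs y
    push_cast at h
    exact h
  have hCU : 0 ≤ (d : ℝ) * (L : ℝ) ^ (j + 1) := by positivity
  obtain ⟨hD, hUsup⟩ := supRegularity_of_localGauge hd hP hWu hWP huP hR1 (by positivity) hCU hB hU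
    (fun y₀ _ => ⟨axialFn W (y₀ - fun _ => (R : ℤ) + 1), fun z => hol_mem_of (S := unitaryUnits (Matrix n n ℂ)) hWu _ _,
      fun z ν hz => norm_axial_sub_one_le_cube hWu hx hWx y₀ R z ν hz, fun z hz => norm_axialDivergence_le hWu hx hx10 hWx hgrad y₀ R z hz⟩) hline
  refine ⟨fun y μ => (hD y μ).trans ?_, fun y => (hUsup y).trans ?_⟩
  · calc 4 * (R : ℝ) * B ≤ 4 * (9 * d * (d : ℝ) * (L : ℝ) ^ (j + 1)) * B := by gcongr
      _ = 36 * d * (d : ℝ) * (L : ℝ) ^ (j + 1) * B := by ring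
  · calc 4 * ((d : ℝ) * (L : ℝ) ^ (j + 1)) * R * B ≤ 4 * ((d : ℝ) * (L : ℝ) ^ (j + 1)) * (9 * d * (d : ℝ) * (L : ℝ) ^ (j + 1)) * B := by gcongr
      _ = 36 * d * (d : ℝ) ^ 2 * ((L : ℝ) ^ (j + 1)) ^ 2 * B := by ring

end

end Summit.QuantumFields.BalabanUV.T4Continuum.NE7PointedSupRegularity
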